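import Summits.ResolutionOfSingularities.ResolutionOfSingularities.Theorems.FrobeniusClosingPatchingRelPerfectDepthMultiHostFormat
import Literature.AlgebraicGeometry.Resolution.HypersurfaceTransform
import Literature.AlgebraicGeometry.Resolution.RegularCentreBlowupOrder
import Literature.AlgebraicGeometry.Resolution.BlowupRestrictOpen
import Literature.AlgebraicGeometry.Resolution.OrderSemicontinuity
import HarnessLib

/-!
# Crux `PatchingRelPerfect` (stmt-ResolutionOfSingularities-16161), chain W5.2 — F7(β) (β-AX) X3 C-I, PC-1 THE POLE CHART:
# a host of generic order ONE along the centre stays a REGULAR HYPERSURFACE at every point over the centre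

[OURS · L1 W5.2 · F7(β) (β-AX) X3 C-I PC-1 · res-L1-w52-plan-1 NAMING G12-15 (hand res-D-pv-021 g9), res-L1-w52-lead-1 POLE-CHART-PLAN
9677f7db11a8df4d (PC-1).]  Replaces the role of NO printed item; NOT a statement of the manuscript under review; fact-free.  AI-written; AI
review is weaker than expert review.  No definitions.

THE POINT.  The tree's `IsBlowup.exists_generator_controlledTransform_hypersurface` (BGMW Lemma 3.6.4 (4): the controlled transform
`σᶜ(H, 1)` of a regular hypersurface `H ⊇`-containing the regular centre is again a regular hypersurface) asks for order-one stalk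
generators at EVERY point of `V(H)`.  A host of the multi-host format is a regular hypersurface only NEAR the pole: it is locally
principal on the cylinder region `V ⊇ W` and has order exactly `1` along the centre `W` (equimultiplicity, stub-1΄s (EQ) + PARAM-lift),
but may be singular elsewhere.  We LOCALISE: on an excellent regular `X` the locus `{ord_y H ≥ 2}` is closed (`isClosed_setOf_le_idealOrder`,
upper semicontinuity needs J-2), so `U := V ∩ {ord_y H ≤ 1}` is an open neighbourhood of `W` on which `H` IS a regular hypersurface; the
blow-up restricts over `U` (`IsBlowup.morphismRestrict`), the controlled transform restricts (`controlledTransform_morphismRestrict`), and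
order-one generators move along the open immersions (iso stalk maps).

* `exists_generator_notMem_sq_comap_of_isIso_stalkMap` / `exists_generator_notMem_sq_of_comap_of_isIso_stalkMap` — «stalk generated by
  an element outside `𝔪²`» descends and lifts along a morphism inducing an isomorphism of local rings.
* **`IsBlowup.exists_generator_controlledTransform_of_idealOrder_eq_one`** (PC-1, core): `X` regular, integral Noetherian and excellent, `π` the blow-up of the
  regular centre `W`, `H` stalkwise principal on an open `V ⊇ W` with `ord_y H = 1` for all `y ∈ W` ⇒ at every `x′` over `W` the controlled
  transform `πᶜ(H, 1)` has a stalk generator outside `𝔪_{x′}²`.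
* **`MultiHostState.exists_generator_step_host`** — the same for host `i` of `S.step τ W η m ν hsnc hτ` when `m i = 1` (`step_host`): THE
  BARE HOST AT THE POLE is a regular hypersurface through every point over the centre (Lemma R΄s carrier candidate).

## References
* E. Bierstone, D. Grigoriev, P. Milman, J. Włodarczyk (2011), Lemma 3.6.4 (4), Def. 3.1.3 (3). [BierstoneGrigorievMilmanWlodarczyk2011]
* V. Cossart, O. Piltant, J. Algebra 320 (2008), proof of Prop. 4.2 (upper semicontinuity of the order). [CossartPiltant2008]
* U. Görtz, T. Wedhorn, *Algebraic Geometry I* (2nd ed., 2020), Prop. 13.91 (blow-ups restrict over opens). [GortzWedhorn2020]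
-/

-- `Summit.<Summit>.<Sub>.Theorems` with `Sub = Summit` (single-conjunct summit, D-0017)
set_option linter.dupNamespace false

noncomputable section

open CategoryTheory AlgebraicGeometry TopologicalSpace IsLocalRing
open Literature.AlgebraicGeometry.Resolution
open Literature.AlgebraicGeometry.Hironaka2017.MonomialPart
open Scheme.IdealSheafData

namespace Summit.ResolutionOfSingularities.ResolutionOfSingularities.Theorems.DepthMultiHost

universe u

/-! ## §1 Order-one generators along isomorphisms of local rings -/

section Stalk

variable {V X : Scheme.{u}} (f : V ⟶ X) (I : X.IdealSheafData) (v : V) [IsIso (f.stalkMap v)]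

/-- **Order-one generators LIFT along an isomorphism of local rings**: if `I_{f v} = (w)` with `w ∉ 𝔪²` and `𝒪_{X,f v} ≅ 𝒪_{V,v}`, then
`(I·𝒪_V)_v` is generated by the image of `w`, again outside `𝔪²`. [folklore] -/
theorem exists_generator_notMem_sq_comap_of_isIso_stalkMap
    (h : ∃ w : X.presheaf.stalk (f v), stalkIdeal I (f v) = Ideal.span {w} ∧ w ∉ maximalIdeal (X.presheaf.stalk (f v)) ^ 2) :
    ∃ w : V.presheaf.stalk v, stalkIdeal (I.comap f) v = Ideal.span {w} ∧ w ∉ maximalIdeal (V.presheaf.stalk v) ^ 2 := by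
  obtain ⟨w, hw, hw2⟩ := h
  have hst : stalkIdeal (I.comap f) v = Ideal.span {(f.stalkMap v).hom w} := by
    rw [stalkIdeal_comap_eq_map_stalkMap, hw, Ideal.map_span, Set.image_singleton]
  refine ⟨(f.stalkMap v).hom w, hst, fun h2 => hw2 ?_⟩
  have h3 : stalkIdeal (I.comap f) v ≤ maximalIdeal (V.presheaf.stalk v) ^ 2 := by
    rw [hst]
    exact (Ideal.span_singleton_le_iff_mem _).mpr h2
  have h4 := (stalkIdeal_comap_le_maximalIdeal_pow_iff_of_isIso_stalkMap f I v 2).mp h3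
  rw [hw] at h4
  exact (Ideal.span_singleton_le_iff_mem _).mp h4

/-- **Order-one generators DESCEND along an isomorphism of local rings**: if `(I·𝒪_V)_v = (w)` with `w ∉ 𝔪²` and `𝒪_{X,f v} ≅ 𝒪_{V,v}`,
then `I_{f v}` is generated by the preimage of `w`, again outside `𝔪²`. [folklore] -/
theorem exists_generator_notMem_sq_of_comap_of_isIso_stalkMap
    (h : ∃ w : V.presheaf.stalk v, stalkIdeal (I.comap f) v = Ideal.span {w} ∧ w ∉ maximalIdeal (V.presheaf.stalk v) ^ 2) :
    ∃ w : X.presheaf.stalk (f v), stalkIdeal I (f v) = Ideal.span {w} ∧ w ∉ maximalIdeal (X.presheaf.stalk (f v)) ^ 2 := by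
  obtain ⟨w, hw, hw2⟩ := h
  have hbij : Function.Bijective (f.stalkMap v).hom := ConcreteCategory.bijective_of_isIso (f.stalkMap v)
  obtain ⟨w₀, hw₀⟩ := hbij.2 w
  have hI : stalkIdeal I (f v) = Ideal.span {w₀} := by
    have h1 : (stalkIdeal I (f v)).map (f.stalkMap v).hom = (Ideal.span {w₀}).map (f.stalkMap v).hom := by
      rw [← stalkIdeal_comap_eq_map_stalkMap, hw, Ideal.map_span, Set.image_singleton, hw₀]
    have h2 := congrArg (Ideal.comap (f.stalkMap v).hom) h1
    rwa [Ideal.comap_map_of_bijective _ hbij, Ideal.comap_map_of_bijective _ hbij] at h2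
  refine ⟨w₀, hI, fun h2 => hw2 ?_⟩
  have h3 : stalkIdeal I (f v) ≤ maximalIdeal (X.presheaf.stalk (f v)) ^ 2 := by
    rw [hI]
    exact (Ideal.span_singleton_le_iff_mem _).mpr h2
  have h4 := (stalkIdeal_comap_le_maximalIdeal_pow_iff_of_isIso_stalkMap f I v 2).mpr h3
  rw [hw] at h4
  exact (Ideal.span_singleton_le_iff_mem _).mp h4

end Stalk

/-! ## §2 PC-1: the controlled transform of a host of order one along the centre -/

/-- **PC-1 (core): a hypersurface of order ONE along a regular centre stays a regular hypersurface over the centre.**  `X` regular, integral Noetherian and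
excellent (the (β-AX) chain΄s `X`), `π : X′ → X` the blow-up of the regular centre `W`, `H` an ideal which is stalkwise principal on an open `V ⊇ W` and has
`ord_y H = 1` at every `y ∈ W`; then at every point `x′` of `X′` over `W` the controlled transform `πᶜ(H, 1) = (π^*H : 𝓘_E)` is
generated by an element outside `𝔪_{x′}²` (by `1` off its support).  Proof: localise to `U = V ∩ {ord H ≤ 1}` (open by upper
semicontinuity of the order on an excellent regular scheme), where BGMW Lemma 3.6.4 (4) applies, and move generators along the open
immersions. [cite: BierstoneGrigorievMilmanWlodarczyk2011, Lemma 3.6.4 (4)] [cite: CossartPiltant2008, proof of Prop. 4.2]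
[cite: GortzWedhorn2020, Prop. 13.91] -/
theorem IsBlowup.exists_generator_controlledTransform_of_idealOrder_eq_one {X X' : Scheme.{u}} [IsIntegral X] [IsNoetherian X]
    (hX : Scheme.IsRegular X) (hXe : Scheme.IsExcellent X) {W : Closeds X} {π : X' ⟶ X} (hπ : IsBlowup π (vanishingIdeal W))
    (hW : Scheme.IsRegular (vanishingIdeal W).subscheme) {H : X.IdealSheafData} (V : X.Opens) (hWV : (W : Set X) ⊆ V)
    (hHV : ∀ y ∈ (V : Set X), ∃ v : X.presheaf.stalk y, stalkIdeal H y = Ideal.span {v})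
    (hord : ∀ y ∈ (W : Set X), idealOrder H y = 1) {x' : X'} (hx' : π x' ∈ (W : Set X)) :
    ∃ w : X'.presheaf.stalk x', stalkIdeal (controlledTransform π (vanishingIdeal W) H 1) x' = Ideal.span {w} ∧
      w ∉ maximalIdeal (X'.presheaf.stalk x') ^ 2 := by
  classical
  haveI : IsProper π := hπ.isProper
  haveI : IsLocallyNoetherian X' := LocallyOfFiniteType.isLocallyNoetherian π
  -- off the support of the transform: the unit ideal
  by_cases hxs : x' ∈ (controlledTransform π (vanishingIdeal W) H 1).support
  swap
  · refine ⟨1, by rw [stalkIdeal_eq_top_of_not_mem_support hxs, Ideal.span_singleton_one], fun h1 => ?_⟩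
    exact (maximalIdeal.isMaximal (X'.presheaf.stalk x')).ne_top
      (Ideal.eq_top_of_isUnit_mem _ (Ideal.pow_le_self two_ne_zero h1) isUnit_one)
  -- `H ≠ ⊥` and `H ⊆ 𝓘_W`
  have hH0 : H ≠ ⊥ := by
    intro h0
    have h1 := hord _ hx'
    have hst : stalkIdeal (⊥ : X.IdealSheafData) (π x') = ⊥ := by
      obtain ⟨U', hU', hyU', -⟩ :=
        exists_isAffineOpen_mem_and_subset (X := X) (x := π x') (U := ⊤) (Opens.mem_top _)
      rw [stalkIdeal_eq_map_germ ⊥ ⟨U', hU'⟩ hyU', Scheme.IdealSheafData.ideal_bot, Pi.bot_apply, Ideal.map_bot]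
    have h2 : ((2 : ℕ) : ℕ∞) ≤ idealOrder H (π x') := by
      rw [le_idealOrder_iff, h0, hst]
      exact bot_le
    rw [h1] at h2
    exact absurd h2 (by decide)
  have hHC : H ≤ vanishingIdeal W := by
    have := le_vanishingIdeal_pow_of_forall_idealOrder_eq hX hW hord
    rwa [pow_one] at this
  -- the open `U = V ∩ {ord H ≤ 1} ⊇ W`
  have hBc : IsClosed {y : X | ((2 : ℕ) : ℕ∞) ≤ idealOrder H y} := isClosed_setOf_le_idealOrder hX hXe hH0 _
  let U : X.Opens := ⟨(V : Set X) ∩ {y : X | ((2 : ℕ) : ℕ∞) ≤ idealOrder H y}ᶜ, V.2.inter hBc.isOpen_compl⟩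
  have hWU : (W : Set X) ⊆ (U : Set X) := by
    intro y hy
    refine ⟨hWV hy, fun h2 => ?_⟩
    have h2' : ((2 : ℕ) : ℕ∞) ≤ idealOrder H y := h2
    rw [hord y hy] at h2'
    exact absurd h2' (by decide)
  -- on `U`, `H` is a regular hypersurface containing the (restricted) centre
  have hπU : IsBlowup (π ∣_ U) ((vanishingIdeal W).comap U.ι) := IsBlowup.morphismRestrict π U hπ
  have hXU : Scheme.IsRegular (U : Scheme.{u}) := Scheme.IsRegular.of_isOpenImmersion U.ι hX
  have hCU : Scheme.IsRegular ((vanishingIdeal W).comap U.ι).subscheme :=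
    Scheme.IsRegular.subscheme_comap_of_isOpenImmersion U.ι hW
  have hHCU : H.comap U.ι ≤ (vanishingIdeal W).comap U.ι := comap_mono U.ι hHC
  have hHU : ∀ y ∈ (H.comap U.ι).support, ∃ v : (U : Scheme.{u}).presheaf.stalk y,
      stalkIdeal (H.comap U.ι) y = Ideal.span {v} ∧ v ∉ maximalIdeal ((U : Scheme.{u}).presheaf.stalk y) ^ 2 := by
    intro y _
    have hyU : U.ι y ∈ (U : Set X) := by
      rw [← Scheme.Opens.range_ι U]
      exact Set.mem_range_self y
    obtain ⟨v, hv⟩ := hHV _ hyU.1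
    refine exists_generator_notMem_sq_comap_of_isIso_stalkMap U.ι H y ⟨v, hv, fun hv2 => hyU.2 ?_⟩
    show ((2 : ℕ) : ℕ∞) ≤ idealOrder H (U.ι y)
    rw [le_idealOrder_iff, hv]
    exact (Ideal.span_singleton_le_iff_mem _).mpr hv2
  -- the point upstairs, in the restricted blow-up
  have hx'U : x' ∈ π ⁻¹ᵁ U := hWU hx'
  let x'' : (π ⁻¹ᵁ U : Scheme.{u}) := ⟨x', hx'U⟩
  have hιx : (π ⁻¹ᵁ U).ι x'' = x' := rfl
  have hxs'' : x'' ∈ (controlledTransform (π ∣_ U) ((vanishingIdeal W).comap U.ι) (H.comap U.ι) 1).support := by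
    rw [controlledTransform_morphismRestrict]
    show x'' ∈ (((controlledTransform π (vanishingIdeal W) H 1).comap (π ⁻¹ᵁ U).ι).support : Set _)
    rw [support_comap]
    exact hxs
  obtain ⟨w, hw, hw2, -⟩ :=
    hπU.exists_generator_controlledTransform_hypersurface hXU hCU hHCU hHU x'' hxs''
  rw [controlledTransform_morphismRestrict] at hw
  have := exists_generator_notMem_sq_of_comap_of_isIso_stalkMap (π ⁻¹ᵁ U).ι
    (controlledTransform π (vanishingIdeal W) H 1) x'' ⟨w, hw, hw2⟩
  rwa [hιx] at this

/-! ## §3 The multi-host reading: the bare host at the pole -/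

namespace MultiHostState

variable {X X' : Scheme.{u}} [IsIntegral X] [IsNoetherian X] (S : MultiHostState X) (τ : X' ⟶ X) (W : Closeds X) (η : X)
  (m : Fin S.n → ℕ) (ν : ℕ) (hsnc : HasSNCWith S.𝓔 (vanishingIdeal W)) (hτ : IsBlowup τ (vanishingIdeal W))

/-- **PC-1: THE BARE HOST AT THE POLE.**  In a format step `S′ = S.step τ W η m ν …` over an excellent regular `X`, a host `i` with
`m i = 1` which is stalkwise principal on an open `V ⊇ W` (in the cylinder: `host i|_V = q^*(tr i)`, `tr i` effective Cartier) and of order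
exactly `1` along the regular centre `W` (equimultiplicity: stub-1΄s (EQ) + PARAM-lift) transforms to `host′ i = τᶜ(host i, 1)`, which at
every point `x′` over `W` is generated by an element outside `𝔪_{x′}²` — a regular hypersurface through the pole (Lemma R΄s carrier
candidate). [cite: BierstoneGrigorievMilmanWlodarczyk2011, Lemma 3.6.4 (4)] [cite: CossartPiltant2008, proof of Prop. 4.2] -/
theorem exists_generator_step_host (hX : Scheme.IsRegular X) (hXe : Scheme.IsExcellent X)
    (hW : Scheme.IsRegular (vanishingIdeal W).subscheme) (V : X.Opens) (hWV : (W : Set X) ⊆ V) (i : Fin S.n)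
    (hHV : ∀ y ∈ (V : Set X), ∃ v : X.presheaf.stalk y, stalkIdeal (S.host i) y = Ideal.span {v}) (hm : m i = 1)
    (hord : ∀ y ∈ (W : Set X), idealOrder (S.host i) y = 1) {x' : X'} (hx' : τ x' ∈ (W : Set X)) :
    ∃ w : X'.presheaf.stalk x', stalkIdeal ((S.step τ W η m ν hsnc hτ).host i) x' = Ideal.span {w} ∧
      w ∉ maximalIdeal (X'.presheaf.stalk x') ^ 2 := by
  rw [step_host, hm]
  exact IsBlowup.exists_generator_controlledTransform_of_idealOrder_eq_one hX hXe hτ hW V hWV hHV hord hx'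

end MultiHostState

end Summit.ResolutionOfSingularities.ResolutionOfSingularities.Theorems.DepthMultiHost

end
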